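import Mathlib
import Summits.CriticalPhenomena.CardyFormulaZ2.Theorems.CardyMagicRigidityPositiveConeDefs
import Summits.CriticalPhenomena.CardyFormulaZ2.Theorems.CardyMagicRigidityNestingRigidityOneGenerationTInterior
import Literature.Probability.Percolation.SiteNestingWeightBound
import Literature.Topology.PlaneTopology.JordanWindingOne
import HarnessLib

/-!
# Lattice regularity of the site-`𝕋` loop ensemble (line `positive-cone-weight-doubling`)

Crux `Summit.CriticalPhenomena.CardyFormulaZ2.Theses.CardyMagicRigidity.NestingRigidity`
(stmt-CriticalPhenomena-4835), line `positive-cone-weight-doubling`, helper toward the registered stub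
`stub_precompactness : PrecompactRegular zEns ∧ PrecompactRegular tEns` (and `stub_treeRigidity`):
the lattice half of "regularity passes to `d_CN`-limits".  At every positive mesh `δ` and for EVERY
site configuration `ω`, the typed full-plane loop configuration `tEns.X δ ω = siteLoopConfig δ ω` of
the honeycomb interface loops is `Regular` (`regular_tEns`), field by field:

* `degreeOne_tEns` — covering degree one: every loop winds `0` or `±1` times about every point (the
  polygon of a cycle of the hexagonal lattice is a Jordan curve, `isJordanLoop_hexJordanLoop`, whose
  inside is the winding interior, `inside_hexJordanLoop_eq`; a Jordan curve winds `±1` about its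
  inside, `IsJordanLoop.wind_eq_one_or_neg_one_of_mem_inside`);
* `boundary_tEns` — the trace is the frontier of the winding interior (`IsJordanLoop.frontier_inside`);
* `laminar_tEns` — winding interiors of two loops are nested or disjoint (`interior_trichotomy`);
* `separating_tEns` — two loops with the same winding interior coincide (equal interiors have equal
  frontiers, i.e. equal traces; a common trace point lies on two dart pieces sharing a face,
  `exists_mem_support_of_mem_polyPiece`; interface loops of one configuration through a common face
  draw the same unbased loop, `IsSiteInterfaceLoop.exists_rebase` + `eq_of_base_eq`);
* `locallyFinite_tEns` — finitely many loops meet every ball (`ncard_loops_siteLoopConfig_meeting_le`).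
-/

noncomputable section

open MeasureTheory Set Filter Metric
open scoped Real Topology BigOperators

namespace Summit.CriticalPhenomena.CardyFormulaZ2.Cruxes.NestingRigidity.PositiveConeWeightDoubling

open Literature.Probability.RandomPlanarGeometry Literature.Probability.Percolation
  Literature.Probability.LatticeModels Literature.Topology.PlaneTopology
open Summit.CriticalPhenomena.CardyFormulaZ2.Cruxes.NestingRigidity.RingCloudTomography
open Summit.CriticalPhenomena.CardyFormulaZ2.Cruxes.NestingRigidity.MarkovCascadeOneGeneration

/-! ## §1 One cycle of the hexagonal lattice: degree one and trace = frontier of the interior -/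

section OneLoop

variable {f₀ f₁ : HexVertex}

/-- The Jordan parametrisation of the polygon of a closed walk of `H` (the local notation of
`…OneGenerationTInterior`, unfolded in all statements). -/
local notation3 "JL⟦" δ ", " w "⟧" =>
  (fun t : ℝ ↦ IccExtend zero_le_one (⇑(hexLoopCurve δ w)) (tailStart (SimpleGraph.Walk.length w) * Int.fract t))

/-- **Covering degree one for the polygon of a cycle of `H`** (`δ ≠ 0`): its winding number about any
point is `0`, `1` or `-1` (off the winding interior it is `0`; on it the point is inside the Jordan
curve `JL⟦δ, w⟧`, which winds `±1` about it and winds like the polygon). -/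
theorem wind_hexLoopCurve_trichotomy {δ : ℝ} (hδ : δ ≠ 0) {w : hexGraph.Walk f₀ f₀} (hw : w.IsCycle)
    (z : ℂ) : (hexLoopCurve δ w).wind z = 0 ∨ (hexLoopCurve δ w).wind z = 1 ∨
      (hexLoopCurve δ w).wind z = -1 := by
  by_cases hz : (hexLoopCurve δ w).wind z = 0
  · exact Or.inl hz
  · right
    have hzr : z ∉ (hexLoopCurve δ w).range := fun h ↦ hz (Curve.wind_of_mem_range h)
    have hin : z ∈ IsJordanLoop.inside (JL⟦δ, w⟧) := by
      rw [inside_hexJordanLoop_eq hδ hw]; exact hz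
    have h := (isJordanLoop_hexJordanLoop hδ hw).wind_eq_one_or_neg_one_of_mem_inside hin
    rwa [wind_hexJordanLoop_sub δ w hzr] at h

/-- The same for the curve class `siteLoopCurve δ w` (definitionally the class of `hexLoopCurve δ w`). -/
theorem wind_siteLoopCurve_trichotomy {δ : ℝ} (hδ : δ ≠ 0) {w : hexGraph.Walk f₀ f₀} (hw : w.IsCycle)
    (z : ℂ) : (siteLoopCurve δ w).wind z = 0 ∨ (siteLoopCurve δ w).wind z = 1 ∨
      (siteLoopCurve δ w).wind z = -1 :=
  wind_hexLoopCurve_trichotomy hδ hw z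

/-- **The trace of the polygon of a cycle of `H` is the frontier of its winding interior** (`δ ≠ 0`):
the interior is the inside of the Jordan curve `JL⟦δ, w⟧`, whose frontier is its range, the trace. -/
theorem range_hexLoopCurve_eq_frontier {δ : ℝ} (hδ : δ ≠ 0) {w : hexGraph.Walk f₀ f₀} (hw : w.IsCycle) :
    (hexLoopCurve δ w).range = frontier {z | (siteLoopCurve δ w).wind z ≠ 0} := by
  have hlen : 0 < w.length := by have := hw.three_le_length; omega
  rw [← inside_hexJordanLoop_eq hδ hw, (isJordanLoop_hexJordanLoop hδ hw).frontier_inside,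
    range_hexJordanLoop δ hlen]

/-- The trace `polyTrace δ w` of a cycle is the frontier of its winding interior. -/
theorem polyTrace_eq_frontier {δ : ℝ} (hδ : δ ≠ 0) {w : hexGraph.Walk f₀ f₀} (hw : w.IsCycle) :
    polyTrace δ w = frontier {z | (siteLoopCurve δ w).wind z ≠ 0} := by
  have hlen : 0 < w.length := by have := hw.three_le_length; omega
  rw [← range_hexLoopCurve_eq_frontier hδ hw, ← range_toCurve_eq_polyTrace hlen]
  rfl

/-- **Two interface loops of one configuration with the same winding interior draw the same unbased
loop** (`δ > 0`): their traces coincide (frontiers of the interiors), a common point lies on two dart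
pieces sharing a face, and interface loops through a common face, rebased there, coincide. -/
theorem unbasedLoop_eq_of_interior_eq {δ : ℝ} (hδ : 0 < δ) {ω : SiteConfig (Site 2)}
    {w : hexGraph.Walk f₀ f₀} {w' : hexGraph.Walk f₁ f₁} (hw : IsSiteInterfaceLoop ω w)
    (hw' : IsSiteInterfaceLoop ω w')
    (h : {z | (siteLoopCurve δ w).wind z ≠ 0} = {z | (siteLoopCurve δ w').wind z ≠ 0}) :
    UnbasedLoop.mk (BasedLoop.mk (siteLoopCurve δ w) (isLoop_siteLoopCurve δ w)) =
      UnbasedLoop.mk (BasedLoop.mk (siteLoopCurve δ w') (isLoop_siteLoopCurve δ w')) := by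
  have hlen : 0 < w.length := by have := hw.isCycle.three_le_length; omega
  -- the traces coincide
  have htr : polyTrace δ w = polyTrace δ w' := by
    rw [polyTrace_eq_frontier hδ.ne' hw.isCycle, polyTrace_eq_frontier hδ.ne' hw'.isCycle, h]
  -- a common point, hence a common face
  obtain ⟨z, hz⟩ : (polyTrace δ w).Nonempty := by
    rw [← range_toCurve_eq_polyTrace hlen]; exact range_nonempty _
  have hz' : z ∈ polyTrace δ w' := htr ▸ hz
  obtain ⟨i, hi, hzi⟩ := mem_polyTrace_iff.1 hz
  obtain ⟨j, hj, hzj⟩ := mem_polyTrace_iff.1 hz'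
  obtain ⟨F, hF, hF'⟩ := exists_mem_support_of_mem_polyPiece hδ.ne' hi hj hzi hzj
  obtain ⟨w₁, hw₁, h₁⟩ := hw.exists_rebase hF δ
  obtain ⟨w₂, hw₂, h₂⟩ := hw'.exists_rebase hF' δ
  rw [← h₁, ← h₂, hw₁.eq_of_base_eq hw₂]

end OneLoop

/-! ## §2 The loops of `tEns.X δ ω` -/

/-- Membership in the loops (both types) of `tEns` at mesh `δ`, unfolded: the unbased loops of the
interface loops of `ω`. -/
theorem mem_loops_tEns_iff {δ : ℝ} {ω : SiteConfig (Site 2)} {u : UnbasedLoop ℂ} :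
    u ∈ (tEns.X δ ω).loops ↔ ∃ (v : HexVertex) (γ : hexGraph.Walk v v), IsSiteInterfaceLoop ω γ ∧
      u = UnbasedLoop.mk (BasedLoop.mk (siteLoopCurve δ γ) (isLoop_siteLoopCurve δ γ)) := by
  constructor
  · rintro (⟨v, γ, hγ, -, rfl⟩ | ⟨v, γ, hγ, -, rfl⟩) <;> exact ⟨v, γ, hγ, rfl⟩
  · rintro ⟨v, γ, hγ, rfl⟩
    by_cases hs : 0 < shoelace (γ.support.map hexCenter)
    · exact Or.inr ⟨v, γ, hγ, ⟨fun _ ↦ hs, fun _ ↦ rfl⟩, rfl⟩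
    · exact Or.inl ⟨v, γ, hγ, ⟨fun h0 ↦ absurd h0 (by decide), fun h' ↦ absurd h' hs⟩, rfl⟩

/-- The winding number of the unbased loop of `siteLoopCurve δ γ` is that of the curve class. -/
theorem wind_mk_siteLoopCurve (δ : ℝ) {v : HexVertex} (γ : hexGraph.Walk v v) (z : ℂ) :
    (UnbasedLoop.mk (BasedLoop.mk (siteLoopCurve δ γ) (isLoop_siteLoopCurve δ γ))).wind z =
      (siteLoopCurve δ γ).wind z :=
  rfl

/-- The trace of the unbased loop of an interface loop is its polygon trace `polyTrace δ γ`. -/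
theorem range_mk_siteLoopCurve_eq_polyTrace (δ : ℝ) {ω : SiteConfig (Site 2)} {v : HexVertex}
    {γ : hexGraph.Walk v v} (hγ : IsSiteInterfaceLoop ω γ) :
    (UnbasedLoop.mk (BasedLoop.mk (siteLoopCurve δ γ) (isLoop_siteLoopCurve δ γ))).range =
      polyTrace δ γ := by
  have hlen : 0 < γ.length := by have := hγ.isCycle.three_le_length; omega
  rw [range_mk_siteLoopCurve, range_toCurve_eq_polyTrace hlen]

/-- **Covering degree one on site-`𝕋`** (field `Regular.degreeOne` at the lattice level): at mesh
`δ > 0`, every loop of `tEns.X δ ω` winds `0`, `1` or `-1` times about every point. -/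
theorem degreeOne_tEns : ∀ {δ : ℝ}, 0 < δ → ∀ (ω : SiteConfig (Site 2)), ∀ u ∈ (tEns.X δ ω).loops, ∀ z : ℂ, u.wind z = 0 ∨ u.wind z = 1 ∨ u.wind z = -1 := by
  intro δ hδ ω u hu z
  obtain ⟨v, γ, hγ, rfl⟩ := mem_loops_tEns_iff.1 hu
  rw [wind_mk_siteLoopCurve]
  exact wind_siteLoopCurve_trichotomy hδ.ne' hγ.isCycle z

/-- **Trace = frontier of the winding interior on site-`𝕋`** (field `Regular.boundary` at the
lattice level): at mesh `δ > 0`, the trace of every loop of `tEns.X δ ω` is the frontier of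
`{z | W ≠ 0}` (no null-interior loops, no two-sided arcs). -/
theorem boundary_tEns : ∀ {δ : ℝ}, 0 < δ → ∀ (ω : SiteConfig (Site 2)), ∀ u ∈ (tEns.X δ ω).loops, u.range = frontier {z | u.wind z ≠ 0} := by
  intro δ hδ ω u hu
  obtain ⟨v, γ, hγ, rfl⟩ := mem_loops_tEns_iff.1 hu
  rw [range_mk_siteLoopCurve_eq_polyTrace δ hγ, polyTrace_eq_frontier hδ.ne' hγ.isCycle]
  rfl

/-- **Laminarity on site-`𝕋`** (field `Regular.laminar` at the lattice level): at mesh `δ > 0`, the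
winding interiors of two loops of `tEns.X δ ω` are nested or disjoint (`interior_trichotomy`). -/
theorem laminar_tEns : ∀ {δ : ℝ}, 0 < δ → ∀ (ω : SiteConfig (Site 2)), ∀ u ∈ (tEns.X δ ω).loops, ∀ v ∈ (tEns.X δ ω).loops, {z | u.wind z ≠ 0} ⊆ {z | v.wind z ≠ 0} ∨ {z | v.wind z ≠ 0} ⊆ {z | u.wind z ≠ 0} ∨ Disjoint {z | u.wind z ≠ 0} {z | v.wind z ≠ 0} := by
  intro δ hδ ω u hu v hv
  obtain ⟨f, γ, hγ, rfl⟩ := mem_loops_tEns_iff.1 hu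
  obtain ⟨f', γ', hγ', rfl⟩ := mem_loops_tEns_iff.1 hv
  simp only [wind_mk_siteLoopCurve]
  rcases interior_trichotomy hγ hγ' hδ with h | h | h
  · exact Or.inr (Or.inl h)
  · exact Or.inl h
  · exact Or.inr (Or.inr h)

/-- **Loops of `tEns.X δ ω` with equal winding interiors are equal** (`δ > 0`; the strong form of
`Regular.separating` on the lattice, `unbasedLoop_eq_of_interior_eq`). -/
theorem eq_of_interior_eq_tEns {δ : ℝ} (hδ : 0 < δ) {ω : SiteConfig (Site 2)} {u v : UnbasedLoop ℂ}
    (hu : u ∈ (tEns.X δ ω).loops) (hv : v ∈ (tEns.X δ ω).loops)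
    (h : {z | u.wind z ≠ 0} = {z | v.wind z ≠ 0}) : u = v := by
  obtain ⟨f, γ, hγ, rfl⟩ := mem_loops_tEns_iff.1 hu
  obtain ⟨f', γ', hγ', rfl⟩ := mem_loops_tEns_iff.1 hv
  exact unbasedLoop_eq_of_interior_eq hδ hγ hγ' h

/-- **Separation on site-`𝕋`** (field `Regular.separating` at the lattice level): at mesh `δ > 0`,
two loops of `tEns.X δ ω` with the same winding interior are equal (or reverse to each other — the
first alternative always holds on the lattice). -/
theorem separating_tEns : ∀ {δ : ℝ}, 0 < δ → ∀ (ω : SiteConfig (Site 2)), ∀ u ∈ (tEns.X δ ω).loops, ∀ v ∈ (tEns.X δ ω).loops, {z | u.wind z ≠ 0} = {z | v.wind z ≠ 0} → u = v ∨ u = v.reverse :=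
  fun hδ _ _ hu _ hv h ↦ Or.inl (eq_of_interior_eq_tEns hδ hu hv h)

/-- **Local finiteness on site-`𝕋`** (field `Regular.locallyFinite` at the lattice level): at mesh
`δ > 0`, only finitely many loops of each type of `tEns.X δ ω` have their trace in a window `B(0, r)`
(they meet `B̄(0, r)`: `ncard_loops_siteLoopConfig_meeting_le`). -/
theorem locallyFinite_tEns : ∀ {δ : ℝ}, 0 < δ → ∀ (ω : SiteConfig (Site 2)), (tEns.X δ ω).IsLocallyFinite := by
  intro δ hδ ω
  refine LoopConfig.IsLocallyFinite.of_finite_window fun i r ↦ ?_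
  refine (ncard_loops_siteLoopConfig_meeting_le hδ r ω).1.subset ?_
  rintro u ⟨hu, hr⟩
  refine ⟨LoopConfig.subset_loops _ i hu, ?_⟩
  obtain ⟨x, hx⟩ := u.range_nonempty
  exact ⟨x, hx, ball_subset_closedBall (hr hx)⟩

/-- **Lattice configurations of site-`𝕋` are regular**: at every mesh `δ > 0` and for every site
configuration `ω`, `tEns.X δ ω = siteLoopConfig δ ω` satisfies all five fields of `Regular` — the
`δ > 0` input of "regularity passes to `d_CN`-limits" in `stub_precompactness`. -/
theorem regular_tEns : ∀ {δ : ℝ}, 0 < δ → ∀ (ω : SiteConfig (Site 2)), Regular (tEns.X δ ω) :=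
  fun hδ ω ↦
    { locallyFinite := locallyFinite_tEns hδ ω
      degreeOne := degreeOne_tEns hδ ω
      boundary := boundary_tEns hδ ω
      laminar := laminar_tEns hδ ω
      separating := separating_tEns hδ ω }

end Summit.CriticalPhenomena.CardyFormulaZ2.Cruxes.NestingRigidity.PositiveConeWeightDoubling

end
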